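import Summits.QuantumFields.YangMills.Theorems.BalabanUVNodesN15KingModelMasslessOSReflectionPositivity
import Literature.MathematicalPhysics.QuantumFieldTheory.OSReconstructionLattice

/-!
# BalabanUVNodes ∕ N15 — THE KING-MODEL RUNG (PART Ͳ-f₂): THE OSTERWALDER–SCHRADER RECONSTRUCTION OF THE MASSLESS BLOCK FIELD `μ⁰_∞` (`d + 1 ≥ 3`), BY NAME
# (Track A, DAG node N15 = NE2; FAN-OUT v1.1 §N15 s3 «KING-MODEL RUNG»; count-neutral)

HONEST FRAMING.  Count-neutral (cell `pub-ymgap`, seat `pub-ymgap-dag-n15-e` g36; `--supports stmt-QuantumFields-27366 --as helper` = K3⁸).  King's `A = 0`, `g = 0` model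
([King1986] C. King, Commun. Math. Phys. **102** (1986) 649–677): the MASSLESS infinite-volume block field `μ⁰_∞` of part Ϻ-x (the block-spin RG fixed point).  Part Ͳ-f₁'s premises
fed to the tree: ★★★ **`king0_isRPMeasureData`** (the tree's `isRPMeasureData_lattice`) and ★★★ **`king0_isOSRealisation`** (the tree's `isOSRealisation_of_isRPMeasureData`): the OS Hilbert
space, OS map and TRANSFER OPERATOR (positive self-adjoint contraction, vacuum) of the critical block field exist by name.  Parts Ͳ-f₃∕f₄: this transfer operator is GAPLESS.
NOT Bałaban's objects; NOT a node discharge; nothing continuum ∕ `ℝ⁴` ∕ Clay.  0 `sorry`, 0 def; standard axioms.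

WHAT THIS FILE PROVES (kernel).  ★★★ **`king0_isRPMeasureData`**, ★★★ **`king0_isOSRealisation`**, `king0_inner_rpMap`, `king0_rpMap_comp_shift`, `king0_transfer_isPositive`, `king0_transfer_norm_le_one`,
`king0_transfer_vacuum`.

HONEST SCOPE.  King's free massless infinite-volume block field, `d + 1 ≥ 3`.  N15 untouched; counts unmoved.
Locators (use): [King1986] Thm 2.1 (2.22) p.654, (4.5) p.670; Glimm–Jaffe 1987 §6.1 Thm. 6.1.3; Osterwalder–Seiler 1978 §2.
-/

noncomputable section

open scoped BigOperators
open MeasureTheory ProbabilityTheory Finset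

namespace Summit.QuantumFields.YangMills.BalabanUVNodes.N15KingModelRung.InfiniteVolume

open Literature.MathematicalPhysics.QuantumFieldTheory (latticeTimeReflection positiveTimeSites positiveTimeEvents latticeTimeShift isRPMeasureData_lattice)
open Literature.Probability.LatticeModels (configReflect IsBoundedMeasurable IsRPMeasureData IsOSRealisation TransferData rpMap rpTransferData
  isOSRealisation_of_isRPMeasureData)

variable {d : ℕ}

/-- ★★★ **`μ⁰_∞` IS AN `IsRPMeasureData`** for the tree's lattice OS data. [cite: King1986, Thm 2.1 (2.22) p.654; GlimmJaffe1987, §6.1 Thm. 6.1.3; OsterwalderSeiler1978, §2] -/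
theorem king0_isRPMeasureData (hd : 2 ≤ d) :
    IsRPMeasureData (kingFieldInf0 d) (configReflect (latticeTimeReflection (d + 1))) (latticeTimeShift (d + 1) ℝ) (positiveTimeEvents (d + 1) ℝ) := by
  haveI := isProbabilityMeasure_kingFieldInf0 hd
  exact isRPMeasureData_lattice _ (king0_isReflectionInvariant hd) (king0_measurePreserving_latticeTimeShift hd) (king0_isReflectionPositive hd)

/-- ★★★ **THE OSTERWALDER–SCHRADER RECONSTRUCTION OF THE MASSLESS BLOCK FIELD** (the tree's construction fed `μ⁰_∞`, one-step operator positive by part Ͳ-f₁).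
[cite: King1986, Thm 2.1 (2.22) p.654; GlimmJaffe1987, §6.1 Thm. 6.1.3; OsterwalderSeiler1978, §2] -/
theorem king0_isOSRealisation (hd : 2 ≤ d) :
    IsOSRealisation (kingFieldInf0 d) (configReflect (latticeTimeReflection (d + 1))) (latticeTimeShift (d + 1) ℝ) (positiveTimeEvents (d + 1) ℝ)
      (rpMap (king0_isRPMeasureData hd)) (rpTransferData (king0_isRPMeasureData hd) (king0_shift_nonneg hd)) :=
  isOSRealisation_of_isRPMeasureData _ _

/-- The OS inner product of `μ⁰_∞` is the reflected pairing. [cite: GlimmJaffe1987, §6.1 (6.1.12)] -/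
theorem king0_inner_rpMap (hd : 2 ≤ d) {F G : ((Fin (d + 1) → ℤ) → ℝ) → ℂ} (hF : IsBoundedMeasurable (positiveTimeEvents (d + 1) ℝ) F)
    (hG : IsBoundedMeasurable (positiveTimeEvents (d + 1) ℝ) G) :
    inner ℂ (rpMap (king0_isRPMeasureData (d := d) hd) F) (rpMap (king0_isRPMeasureData hd) G)
      = ∫ ω, starRingEnd ℂ (F (configReflect (latticeTimeReflection (d + 1)) ω)) * G ω ∂kingFieldInf0 d :=
  (king0_isOSRealisation hd).inner_eq F G hF hG

/-- The unit time shift of `μ⁰_∞` is implemented by its transfer operator. [cite: GlimmJaffe1987, §6.1 Thm. 6.1.3] -/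
theorem king0_rpMap_comp_shift (hd : 2 ≤ d) {G : ((Fin (d + 1) → ℤ) → ℝ) → ℂ} (hG : IsBoundedMeasurable (positiveTimeEvents (d + 1) ℝ) G) :
    rpMap (king0_isRPMeasureData (d := d) hd) (G ∘ latticeTimeShift (d + 1) ℝ)
      = (rpTransferData (king0_isRPMeasureData hd) (king0_shift_nonneg hd)).T (rpMap (king0_isRPMeasureData hd) G) :=
  (king0_isOSRealisation hd).map_shift G hG

/-- The transfer operator of `μ⁰_∞` is positive. [cite: GlimmJaffe1987, §6.1 Thm. 6.1.3] -/
theorem king0_transfer_isPositive (hd : 2 ≤ d) :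
    (rpTransferData (king0_isRPMeasureData (d := d) hd) (king0_shift_nonneg hd)).T.IsPositive :=
  (rpTransferData _ _).isPositive

/-- The transfer operator of `μ⁰_∞` is a contraction. [cite: GlimmJaffe1987, §6.1 Thm. 6.1.3 (iii)] -/
theorem king0_transfer_norm_le_one (hd : 2 ≤ d) :
    ‖(rpTransferData (king0_isRPMeasureData (d := d) hd) (king0_shift_nonneg hd)).T‖ ≤ 1 :=
  (rpTransferData _ _).norm_le_one

/-- The transfer operator of `μ⁰_∞` fixes the unit vacuum `Ω = ι 1`. [cite: GlimmJaffe1987, §6.1 Thm. 6.1.3] -/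
theorem king0_transfer_vacuum (hd : 2 ≤ d) :
    (rpTransferData (king0_isRPMeasureData (d := d) hd) (king0_shift_nonneg hd)).T (rpTransferData (king0_isRPMeasureData hd) (king0_shift_nonneg hd)).vacuum
        = (rpTransferData (king0_isRPMeasureData hd) (king0_shift_nonneg hd)).vacuum
      ∧ ‖(rpTransferData (king0_isRPMeasureData (d := d) hd) (king0_shift_nonneg hd)).vacuum‖ = 1
      ∧ rpMap (king0_isRPMeasureData (d := d) hd) 1 = (rpTransferData (king0_isRPMeasureData hd) (king0_shift_nonneg hd)).vacuum :=
  ⟨(rpTransferData _ _).map_vacuum, (rpTransferData _ _).norm_vacuum, (king0_isOSRealisation hd).map_one⟩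

end Summit.QuantumFields.YangMills.BalabanUVNodes.N15KingModelRung.InfiniteVolume
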